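import Literature.AlgebraicGeometry.HodgeTheory.TopHodgeClassesSpannedByPullbacksHolds
import Literature.AlgebraicGeometry.HodgeTheory.HyperplaneClassRational
import Literature.AlgebraicGeometry.Motives.AbelianVarietyPrincipalPolarization
import HarnessLib

/-!
# The class of a divisor is rational up to the model's normalisation: `c₁(𝒪_X(D)) ∈ λ_A · H²(X(ℂ); ℚ)`
# for ONE scalar `λ_A ≠ 0` (Voisin I, Thm. 11.33: `[D] = c₁(𝒪_X(D)) ∈ H²(X, ℤ)`)

Family `hodge`, layer `Literature/AlgebraicGeometry/HodgeTheory`. Companion of `CartierDivisorChernClass` (the class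
`ch(D) := ch₁ᴬ(𝒪_X(D)^an) ∈ H²(X(ℂ); ℂ)` of a Cartier divisor on a Hodge model `A` is ALGEBRAIC) and of
`Motives/AbelianVarietyPrincipalPolarization` (`IsDivisorClassLineOf n X D θ`: `θ` on the complex LINE `ℂ·ch(D)`;
`AbelianVariety.IsPolarizationClassOf Θ θ`: a RATIONAL non-zero point of that line — there recorded as "asked for, not
constructed": HONEST LIMIT 1 of the typer seat `hodge-lit-avcarriers`). In print `c₁(𝒪_X(D)) = [D]` is an INTEGRAL
class (Voisin I Thm. 11.33 with §11.1.2 / Thm. 7.10; Lange §2.1.1 "a polarization is the first Chern class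
`c₁(L) ∈ H²(X, ℤ)`"); on the tree's real carrier the model's `ch₁ᴬ` is normalised through the comparison family
`A.deRham` only up to ONE non-zero complex scalar (module docstrings of `HolomorphicBundleChernCharacter`,
`ChernCharacterTautologicalPullback`). This file PROVES the corresponding honest statement:

* `exists_ne_zero_forall_chernCharacter_cartierDivisorCocycle_eq_smul` — **for `X` smooth projective with Hodge model `A`
  there is ONE `λ ≠ 0` such that for EVERY Cartier divisor `D`, `ch(D) = λ • ρ_D` with `ρ_D` a RATIONAL class.**
  Proof (the tree's Lefschetz-`(1,1)`-in-embedding-currency bookkeeping, `LefschetzOneOneEmbeddingCurrency`, run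
  for an arbitrary `D`): for a projective embedding `ι : X ⟶ ℙᴺ` with hyperplane divisor `H`, `D + m₁H` has a non-zero
  section, so `E = D + m₁H + div t₁` is effective; Serre's theorem A in divisor form
  (`Motives.CartierDivisor.effectiveCartier_linEquiv_hyperplanePullbacks`) gives `E + D_F ∼ m • H`; along the Segre
  embedding `Σ = (ι, F) ≫ σ`, `ch(D_Σ) = ch(H) + ch(D_F)`; hence `ch(D) = (1 + m - m₁)·ch(H) - ch(D_Σ)` with
  `ch(H) = -c_ι`, `ch(D_Σ) = -c_Σ` (`c_Φ = ch₁ᴬ(𝒪(-1)|_X)` the tautological class of a closed immersion `Φ`); and for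
  every closed immersion `Φ : X ⟶ ℙᴷ`, by projective Noether normalisation `ψ : X ⟶ ℙ^{dim X}` with `ψ^*H ∼ m_Φ • D_Φ`
  (`IsSmoothProjective.exists_isFinite_surjective_hyperplane_pullback_linEquiv`), `m_Φ • c_Φ = ch₁ᴬ((ψ^an)⁻¹𝒪(-1)) =
  r • ψ^*c_{ℙ}` (`chernCharacter_tautologicalBundle_pullback_eq_smul_of_linEquiv`,
  `exists_chernCharacter_tautologicalBundle_pullback_eq_smul_map`: ONE `r ≠ 0` for all `ψ`) and `c_ℙ = z • r₀`, `r₀`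
  the rational generator of `H²(ℙ^{dim X}(ℂ); ℂ)`, `z ≠ 0`; so `λ := r z` works for every `Φ`, hence for every `D`;
* `exists_isRationalClass_isDivisorClassLineOf` — **every divisor line `ℂ·ch(D)` contains a rational class `ρ` with
  `ch(D) = λρ`** (so `ρ ≠ 0 ⟺ ch(D) ≠ 0`);
* `AbelianVariety.exists_isPolarizationClassOf_of_chernCharacter_ne_zero` — on a complex abelian variety, **`Θ` has a
  polarisation class `θ ∈ ℚˣ·[Θ]` (`IsPolarizationClassOf Θ θ`) as soon as `ch(Θ) ≠ 0` in some Hodge model**, and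
  `AbelianVariety.exists_isPrincipalPolarizationClass_of_chernCharacter_ne_zero` (the shape `𝔄 X θ` of the ring-2 anchors
  is INHABITED over such `Θ`); the non-vanishing is supplied for hyperplane divisors of projective embeddings by
  `chernCharacter_cartierDivisorCocycle_divisor_ne_zero` (`ch(H_ι) = -c_ι ≠ 0`, `dim X ≥ 1`) — for a general ample
  `Θ` (`kΘ ∼ H_ι`) it is NOT proved here (no "sections of `𝒪(kΘ)` embed with hyperplane divisor `∼ kΘ`" lemma on the
  tree's `CartierDivisor.toGeneratingSections` yet) — recorded, not hidden.

Everything is proved; no definition and no named fact is introduced.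

## References

* [VoisinHodgeI2002] C. Voisin, *Hodge Theory and Complex Algebraic Geometry I* (CUP 2002), §7.1.2, Thm. 7.10, §11.1.2,
  Thm. 11.30, Thm. 11.33 (`[D] = c₁(𝒪_X(D))` integral).
* [Lange2023AbelianVarietiesComplex] H. Lange, *Abelian Varieties over the Complex Numbers* (2023), §2.1.1 (p. 68:
  "a polarization on `X` is by definition the first Chern class `H = c₁(L)`").
* [Hartshorne1977] R. Hartshorne, *Algebraic Geometry*, II Thm. 5.17, II Thm. 7.1, II Ex. 5.12 (Serre A; Segre).
* [GortzWedhorn2020] U. Görtz, T. Wedhorn, *Algebraic Geometry I*, 2nd ed., Prop. 11.21, Thm. 13.89 (Noether normalisation).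
* [HatcherAT2002] A. Hatcher, *Algebraic Topology*, Thm. 3.19 (`H²(ℙᴺ(ℂ); ℚ) = ℚ`).
* Tree: `LefschetzOneOneEmbeddingCurrency` (the bookkeeping copied here for an arbitrary `D`),
  `TopHodgeClassesSpannedByPullbacksOfInputs` (the Noether step), `ChernCharacterTautologicalPullback`,
  `ChernCharacterTautologicalLinEquiv`, `Motives/SmoothProjectiveNoetherLinEquiv`, `Motives/EffectiveCartierSerreA`,
  `HyperplaneClassRational`, `HolomorphicBundleChernCharacterTopDegree`.
-/

noncomputable section

open scoped Manifold ContDiff Topology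
open CategoryTheory AlgebraicGeometry TopologicalSpace Opposite Set Filter

namespace Literature.AlgebraicGeometry.HodgeTheory

open Literature.AlgebraicGeometry.Motives Literature.AlgebraicGeometry.Motives.RatFn
  Literature.AlgebraicGeometry.Motives.AlgPoints Literature.AlgebraicGeometry.Motives.AnalytificationKaehler
  Literature.NumberTheory.Transcendental Literature.Geometry.Kaehler
open Literature.AlgebraicTopology.SingularHomology

section HodgeTheory

variable {n : ℕ} {T : Motives.SchemeOver ℂ}

/-- **The tautological classes `c_Φ = ch₁ᴬ(𝒪(-1)|_X)` of ALL closed immersions `Φ : X ⟶ ℙᴷ` lie on ONE complex ray of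
rational classes**: for `X` smooth projective of dimension `d + 1` with Hodge model `A` there is `λ ≠ 0` with
`c_Φ = λ • ρ_Φ`, `ρ_Φ` rational, for every `K` and every closed immersion `Φ` (projective Noether normalisation `ψ`
with `ψ^*H ∼ m • D_Φ`, `m • c_Φ = ch₁((ψ^an)⁻¹𝒪(-1)) = r • ψ^*(z • r₀)`; module docstring).
[cite: VoisinHodgeI2002, Thm. 11.33 and §7.1.2] [cite: GortzWedhorn2020, Thm. 13.89] -/
theorem exists_ne_zero_forall_chernCharacter_tautologicalBundle_eq_smul (hT : IsSmoothProjective (n + 1) T)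
    (A : HodgeModel (n + 1) T) :
    ∃ l : ℂ, l ≠ 0 ∧ ∀ {K : ℕ} (Φ : T ⟶ projectiveSpace K ℂ) [IsClosedImmersion Φ.left],
      ∃ ρ : complexBetti T (2 * 1), IsRationalClass ρ ∧
        A.chernCharacter (tautologicalBundle Φ A.isAnalytification) 1 = l • ρ := by
  haveI : IsIntegral T.left := IsSmoothProjective.isIntegral_holds hT
  -- a Hodge model `B'` of `ℙ^{n+1}`, its tautological class `cB' = z • r₀ ≠ 0`, `r₀` rational
  have hP' : IsSmoothProjective (n + 1) (projectiveSpace (n + 1) ℂ) := isSmoothProjective_projectiveSpace' (n + 1)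
  haveI hid' : IsClosedImmersion (𝟙 (projectiveSpace (n + 1) ℂ) : projectiveSpace (n + 1) ℂ ⟶ _).left :=
    show IsClosedImmersion (𝟙 (projectiveSpace (n + 1) ℂ).left) from inferInstance
  obtain ⟨B'⟩ := (nonempty_hodgeModel_holds (n := n + 1) (X := projectiveSpace (n + 1) ℂ)).nonempty hP'
  set cB' : complexBetti (projectiveSpace (n + 1) ℂ) (2 * 1) :=
    B'.chernCharacter (tautologicalBundle (𝟙 (projectiveSpace (n + 1) ℂ)) B'.isAnalytification) 1 with hcB'def
  have hcB' : cB' ≠ 0 := by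
    obtain ⟨c, hc, hc0⟩ := HodgeModel.exists_mem_chernCharacterSet_tautologicalBundle_ne_zero
      (𝟙 (projectiveSpace (n + 1) ℂ)) B' hP' (p := 1) (by omega)
    rwa [hcB'def, B'.chernCharacter_eq_of_mem hc]
  obtain ⟨r₀, hr₀, hgen⟩ := exists_isRationalClass_forall_eq_smul_projectiveSpace (n + 1)
  obtain ⟨z, hz⟩ := hgen cB'
  have hz0 : z ≠ 0 := by
    rintro rfl
    exact hcB' (by rw [hz, zero_smul])
  -- ONE scalar `r ≠ 0` for all `ψ : T ⟶ ℙ^{n+1}`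
  obtain ⟨r, hr, hrψ⟩ := HodgeModel.exists_chernCharacter_tautologicalBundle_pullback_eq_smul_map hT A B' le_rfl
  refine ⟨r * z, mul_ne_zero hr hz0, fun {K} Φ _ ↦ ?_⟩
  -- Noether normalisation of `Φ`: `ψ^*H ∼ m • D_Φ`, so `m • c_Φ = ch₁((ψ^an)⁻¹𝒪(-1)) = r • ψ^* cB'`
  obtain ⟨j₀, hj₀⟩ := (GeneratingSections.ofHom Φ.left).exists_mem_U (genericPoint T.left)
  obtain ⟨ψ, m, hψ, hm, -, -, hlin⟩ :=
    IsSmoothProjective.exists_isFinite_surjective_hyperplane_pullback_linEquiv hT Φ j₀ hj₀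
  have hC := HodgeModel.chernCharacter_tautologicalBundle_pullback_eq_smul_of_linEquiv hT A B' Φ ψ hψ j₀ hj₀ m hlin
  have h2 := hrψ ψ
  rw [hC, ← hcB'def, hz, _root_.map_smul] at h2
  have hm0 : (m : ℂ) ≠ 0 := by exact_mod_cast hm.ne'
  refine ⟨(((m : ℚ)⁻¹ : ℚ) : ℂ) • complexBetti.map ψ (2 * 1) r₀, (hr₀.pullback _).smul _, ?_⟩
  have e : A.chernCharacter (tautologicalBundle Φ A.isAnalytification) 1 =
      (m : ℂ)⁻¹ • ((m : ℂ) • A.chernCharacter (tautologicalBundle Φ A.isAnalytification) 1) := by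
    rw [smul_smul, inv_mul_cancel₀ hm0, one_smul]
  rw [e, h2, smul_smul, smul_smul, smul_smul]
  congr 1
  push_cast
  ring

/-- **`c₁(𝒪_X(D))` is rational up to the model's normalisation, uniformly in `D`.** For `X` smooth projective of
dimension `n` with Hodge model `A` there is ONE `λ ≠ 0` such that for EVERY Cartier divisor `D` on `X`,
`ch₁ᴬ(𝒪_X(D)^an) = λ • ρ_D` with `ρ_D ∈ H²(X(ℂ); ℂ)` RATIONAL — the real-carrier form of "`[D] = c₁(𝒪_X(D))` is an
integral class" (Voisin I Thm. 11.33 / §7.1.2; Lange §2.1.1). Proof: Serre A + Segre bookkeeping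
`ch(D) = (1 + m - m₁)·ch(H) - ch(D_Σ)`, `ch(H) = -c_ι`, `ch(D_Σ) = -c_Σ`, and the previous theorem (module docstring).
[cite: VoisinHodgeI2002, Thm. 11.33 and §7.1.2] [cite: Lange2023AbelianVarietiesComplex, §2.1.1 (p. 68)]
[cite: Hartshorne1977, II Thm. 5.17, II Thm. 7.1 and II Ex. 5.12] -/
theorem exists_ne_zero_forall_chernCharacter_cartierDivisorCocycle_eq_smul [IsIntegral T.left]
    (hT : IsSmoothProjective n T) (A : HodgeModel n T) :
    ∃ l : ℂ, l ≠ 0 ∧ ∀ D : CartierDivisor T.left, ∃ ρ : complexBetti T (2 * 1), IsRationalClass ρ ∧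
      A.chernCharacter (cartierDivisorCocycle A.isAnalytification D) 1 = l • ρ := by
  -- dimension `0`: `H²(X(ℂ); ℂ) = 0`
  rcases Nat.eq_zero_or_pos n with rfl | hn
  · haveI : Subsingleton (complexBetti T (2 * 1)) :=
      Motives.ComplexPoints.subsingleton_singularCohomology_of_lt hT ℂ (k := 2 * 1) (by omega)
    exact ⟨1, one_ne_zero, fun D ↦ ⟨0, IsRationalClass.zero, Subsingleton.elim _ _⟩⟩
  obtain ⟨d, rfl⟩ : ∃ d, n = d + 1 := ⟨n - 1, by omega⟩
  haveI : CompactSpace T.left := hT.isProjectiveOver.compactSpace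
  obtain ⟨l, hl, hcur⟩ := exists_ne_zero_forall_chernCharacter_tautologicalBundle_eq_smul hT A
  refine ⟨l, hl, fun D ↦ ?_⟩
  -- an embedding `ι : T ⟶ ℙᴺ` and its hyperplane divisor `H = (ι^*x_{j₀})`
  obtain ⟨N, ι, hι⟩ := hT.isProjectiveOver
  set G := GeneratingSections.affineChartData ι with hG
  obtain ⟨j₀, hj₀⟩ := G.exists_mem_U (genericPoint T.left)
  -- the one-section twist: `D + m₁ H` has a non-zero section `t₁`; `E = D + m₁ H + div t₁` is effective
  have ht : ((1 : ℕ) • G.divisor j₀ hj₀).IsSection (G.ratioFn j₀ j₀ hj₀) := by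
    rw [CartierDivisor.one_smul]
    exact G.isSection_divisor_ratioFn j₀ hj₀ j₀
  have ht0 : G.ratioFn j₀ j₀ hj₀ ≠ 0 := G.ratioFn_ne_zero j₀ j₀ hj₀ hj₀
  have haff : IsAffineOpen (((1 : ℕ) • G.divisor j₀ hj₀).nonvanishingOpens (G.ratioFn j₀ j₀ hj₀)) := by
    rw [CartierDivisor.one_smul, show (G.divisor j₀ hj₀).nonvanishingOpens (G.ratioFn j₀ j₀ hj₀) = G.U j₀ from
      Opens.ext (G.nonvanishing_divisor_ratioFn j₀ hj₀ j₀)]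
    exact GeneratingSections.isAffineOpen_affineChartData_U ι j₀
  obtain ⟨m₁, -, t₁, -, -, ht₁, ht₁0⟩ :=
    CartierDivisor.exists_isSection_add_smul_of_isAffineOpen D (G.divisor j₀ hj₀) one_pos ht ht0 haff
  have hE : (D + m₁ • G.divisor j₀ hj₀ + CartierDivisor.principal t₁ ht₁0).IsEffective :=
    (CartierDivisor.isEffective_add_principal_iff ht₁0).2 ht₁
  -- Serre's theorem A in divisor form
  obtain ⟨m, M', F, k₀, hk₀, hlin⟩ := CartierDivisor.effectiveCartier_linEquiv_hyperplanePullbacks hT ι j₀ hj₀ _ hE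
  -- the Segre embedding `Σ = (ι, F) ≫ σ`, a closed immersion
  haveI := SegreHyperplaneClass.isSeparated_projectiveSpace_hom M'
  haveI : IsClosedImmersion (CartesianMonoidalCategory.lift ι F).left := by
    have h : (CartesianMonoidalCategory.lift ι F).left ≫
        (CartesianMonoidalCategory.fst (projectiveSpace N ℂ) (projectiveSpace M' ℂ)).left = ι.left := by
      rw [← Over.comp_left, CartesianMonoidalCategory.lift_fst]
    haveI : IsSeparated (CartesianMonoidalCategory.fst (projectiveSpace N ℂ) (projectiveSpace M' ℂ)).left :=
      inferInstanceAs (IsSeparated (Limits.pullback.fst (projectiveSpace N ℂ).hom (projectiveSpace M' ℂ).hom))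
    haveI : IsClosedImmersion ((CartesianMonoidalCategory.lift ι F).left ≫
        (CartesianMonoidalCategory.fst (projectiveSpace N ℂ) (projectiveSpace M' ℂ)).left) := by
      rw [h]
      infer_instance
    exact IsClosedImmersion.of_comp _ (CartesianMonoidalCategory.fst (projectiveSpace N ℂ) (projectiveSpace M' ℂ)).left
  haveI : IsClosedImmersion (CartesianMonoidalCategory.lift ι F ≫ segreEmbedding N M' ℂ).left := by
    rw [Over.comp_left]
    infer_instance
  have hab : genericPoint T.left ∈ (GeneratingSections.affineChartData
      (CartesianMonoidalCategory.lift ι F ≫ segreEmbedding N M' ℂ)).U (segreIndexEquiv N M' (j₀, k₀)) := by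
    rw [affineChartData_lift_segreEmbedding_U]
    exact ⟨hj₀, hk₀⟩
  -- Chern character bookkeeping in `H²(T(ℂ); ℂ)`
  set cH := A.chernCharacter (cartierDivisorCocycle A.isAnalytification (G.divisor j₀ hj₀)) 1 with hcH
  set cD := A.chernCharacter (cartierDivisorCocycle A.isAnalytification D) 1 with hcD
  set cF := A.chernCharacter (cartierDivisorCocycle A.isAnalytification
    ((GeneratingSections.affineChartData F).divisor k₀ hk₀)) 1 with hcF
  set cE := A.chernCharacter (cartierDivisorCocycle A.isAnalytification
    (D + m₁ • G.divisor j₀ hj₀ + CartierDivisor.principal t₁ ht₁0)) 1 with hcE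
  set cS := A.chernCharacter (cartierDivisorCocycle A.isAnalytification ((GeneratingSections.affineChartData
    (CartesianMonoidalCategory.lift ι F ≫ segreEmbedding N M' ℂ)).divisor (segreIndexEquiv N M' (j₀, k₀)) hab)) 1 with hcS
  have e1 : cE = cD + (m₁ : ℂ) • cH := by
    rw [hcE, ← A.chernCharacter_cartierDivisorCocycle_eq_of_linEquiv ⟨t₁, ht₁0, CartierDivisor.SameDivisor.refl _⟩,
      A.chernCharacter_cartierDivisorCocycle_add, A.chernCharacter_cartierDivisorCocycle_smul]
  have e2 : cF = (m : ℂ) • cH - cE := by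
    refine eq_sub_of_add_eq' ?_
    rw [hcE, hcF, ← A.chernCharacter_cartierDivisorCocycle_add, A.chernCharacter_cartierDivisorCocycle_eq_of_linEquiv hlin,
      A.chernCharacter_cartierDivisorCocycle_smul]
  have e3 : cS = cH + cF := A.chernCharacter_cartierDivisorCocycle_divisor_segre ι F j₀ hj₀ k₀ hk₀ hab
  have key : cD = cH + (m : ℂ) • cH - (m₁ : ℂ) • cH - cS := by
    rw [e3, e2, e1]
    abel
  -- `cH = -c_ι = -l ρ_ι`, `cS = -c_Σ = -l ρ_Σ`
  obtain ⟨ρι, hρι, hcι⟩ := hcur ι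
  obtain ⟨ρS, hρS, hcS'⟩ := hcur (CartesianMonoidalCategory.lift ι F ≫ segreEmbedding N M' ℂ)
  have hH : cH = -(l • ρι) := by
    rw [hcH, A.chernCharacter_cartierDivisorCocycle_divisor_eq_neg ι j₀ hj₀, hcι]
  have hS : cS = -(l • ρS) := by
    rw [hcS, A.chernCharacter_cartierDivisorCocycle_divisor_eq_neg _ _ hab, hcS']
  refine ⟨(((-(1 + (m : ℚ) - m₁)) : ℚ) : ℂ) • ρι + ρS, (hρι.smul _).add hρS, ?_⟩
  rw [key, hH, hS]
  push_cast
  module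

/-- **Every divisor line `ℂ·c₁(𝒪_X(D))` contains a RATIONAL class `ρ` with `c₁(𝒪_X(D)) = λρ`, `λ ≠ 0`** (so
`IsDivisorClassLineOf n X D ρ`, and `ρ ≠ 0 ⟺ ch(D) ≠ 0`): the rational point asked for by
`AbelianVariety.IsPolarizationClassOf` exists. [cite: VoisinHodgeI2002, Thm. 11.33 and §7.1.2] -/
theorem exists_isRationalClass_isDivisorClassLineOf [IsIntegral T.left] (hT : IsSmoothProjective n T)
    (A : HodgeModel n T) (D : CartierDivisor T.left) :
    ∃ (ρ : complexBetti T 2) (l : ℂ), l ≠ 0 ∧ IsRationalClass ρ ∧ IsDivisorClassLineOf n T D ρ ∧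
      A.chernCharacter (cartierDivisorCocycle A.isAnalytification D) 1 = l • ρ := by
  obtain ⟨l, hl, h⟩ := exists_ne_zero_forall_chernCharacter_cartierDivisorCocycle_eq_smul hT A
  obtain ⟨ρ, hρ, he⟩ := h D
  refine ⟨ρ, l, hl, hρ, ⟨A, l⁻¹, ?_⟩, he⟩
  rw [he, smul_smul, inv_mul_cancel₀ hl, one_smul]

/-- **`ch(H_ι) ≠ 0` for the hyperplane divisor `H_ι = (ι^*x_{j₀})` of a closed immersion `ι : X ⟶ ℙᴺ`, `dim X ≥ 1`**
(`ch(H_ι) = -c_ι`, `CartierCocycleChernCalculus`, and `c_ι = ch₁(𝒪(-1)|_X) ≠ 0`, `HolomorphicBundleChernCharacterTopDegree`: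
`[θ_ι] ≠ 0`). [cite: VoisinHodgeI2002, §3.3.2 Lemma 3.16 and Thm. 11.33] -/
theorem chernCharacter_cartierDivisorCocycle_divisor_ne_zero [IsIntegral T.left] (hT : IsSmoothProjective n T)
    (A : HodgeModel n T) (hn : 1 ≤ n) {N : ℕ} (ι : T ⟶ projectiveSpace N ℂ) [IsClosedImmersion ι.left]
    (j₀ : Fin (N + 1)) (hj₀ : genericPoint T.left ∈ (GeneratingSections.ofHom ι.left).U j₀) :
    A.chernCharacter (cartierDivisorCocycle A.isAnalytification ((GeneratingSections.ofHom ι.left).divisor j₀ hj₀)) 1 ≠ 0 := by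
  obtain ⟨c, hc, hc0⟩ := HodgeModel.exists_mem_chernCharacterSet_tautologicalBundle_ne_zero ι A hT (p := 1) hn
  rw [A.chernCharacter_cartierDivisorCocycle_divisor_eq_neg ι j₀ hj₀, A.chernCharacter_eq_of_mem hc, neg_ne_zero]
  exact hc0

end HodgeTheory

end Literature.AlgebraicGeometry.HodgeTheory

/-! ### Polarisation classes of complex abelian varieties are INHABITED over divisors with `ch ≠ 0` -/

namespace Literature.AlgebraicGeometry.Motives

namespace AbelianVariety

open Literature.AlgebraicGeometry.HodgeTheory

variable (A : AbelianVariety ℂ)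

/-- **`Θ` has a polarisation class `θ ∈ ℚˣ·[Θ]`** (`A.IsPolarizationClassOf Θ θ`: rational, non-zero, on the line
`ℂ·c₁(𝒪_A(Θ))`) **as soon as `c₁(𝒪_A(Θ)) ≠ 0` in some Hodge model** — the rational point of the line is
`λ⁻¹·ch(Θ)` (`exists_isRationalClass_isDivisorClassLineOf`). Lifts HONEST LIMIT 1 of the name table of seat
`hodge-lit-avcarriers` to the non-vanishing of `ch(Θ)`. [cite: Lange2023AbelianVarietiesComplex, §2.1.1 (p. 68)]
[cite: VoisinHodgeI2002, Thm. 11.33] -/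
theorem exists_isPolarizationClassOf_of_chernCharacter_ne_zero (M : HodgeModel A.dim A.X) (Θ : CartierDivisor A.X.left)
    (hΘ : M.chernCharacter (cartierDivisorCocycle M.isAnalytification Θ) 1 ≠ 0) :
    ∃ θ : complexBetti A.X 2, A.IsPolarizationClassOf Θ θ := by
  obtain ⟨ρ, l, -, hρ, hline, he⟩ := exists_isRationalClass_isDivisorClassLineOf isSmoothProjective_holds M Θ
  refine ⟨ρ, hρ, ?_, hline⟩
  rintro rfl
  exact hΘ (by rw [he, smul_zero])

/-- **The anchor shape `𝔄 A.X θ` is inhabited**: a principal polarisation divisor `Θ` with `ch(Θ) ≠ 0` in some Hodge model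
has a principal polarisation CLASS `θ` (`A.IsPrincipalPolarizationClass θ`). [cite: Lange2023AbelianVarietiesComplex, §2.1.1 (p. 68)]
[cite: VoisinHodgeI2002, Thm. 11.33] -/
theorem exists_isPrincipalPolarizationClass_of_chernCharacter_ne_zero (M : HodgeModel A.dim A.X)
    {Θ : CartierDivisor A.X.left} (hP : A.IsPrincipalPolarizationDivisor Θ)
    (hΘ : M.chernCharacter (cartierDivisorCocycle M.isAnalytification Θ) 1 ≠ 0) :
    ∃ θ : complexBetti A.X 2, A.IsPrincipalPolarizationClass θ := by
  obtain ⟨θ, hθ⟩ := A.exists_isPolarizationClassOf_of_chernCharacter_ne_zero M Θ hΘ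
  exact ⟨θ, Θ, hP, hθ⟩

/-- **Uniformity: all polarisation classes of all divisors of `A` read in one model lie in `λ_M · H²(A(ℂ); ℚ)`** — for a
Hodge model `M` there is `λ ≠ 0` with `ch^M(Θ) ∈ λ • {rational classes}` for every `Θ`; in particular two divisors
`Θ, Θ'` have polarisation classes `λ⁻¹ch(Θ)`, `λ⁻¹ch(Θ')` with the SAME `λ` (so that e.g. `ch(Θ) + ch(Θ')`, `m^*ch(Θ)`
stay on rational rays). [cite: VoisinHodgeI2002, Thm. 11.33 and §7.1.2] -/
theorem exists_ne_zero_forall_isRationalClass_inv_smul_chernCharacter (M : HodgeModel A.dim A.X) :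
    ∃ l : ℂ, l ≠ 0 ∧ ∀ Θ : CartierDivisor A.X.left,
      IsRationalClass (l⁻¹ • M.chernCharacter (cartierDivisorCocycle M.isAnalytification Θ) 1) := by
  obtain ⟨l, hl, h⟩ := exists_ne_zero_forall_chernCharacter_cartierDivisorCocycle_eq_smul isSmoothProjective_holds M
  refine ⟨l, hl, fun Θ ↦ ?_⟩
  obtain ⟨ρ, hρ, he⟩ := h Θ
  rw [he, smul_smul, inv_mul_cancel₀ hl, one_smul]
  exact hρ

end AbelianVariety

end Literature.AlgebraicGeometry.Motives

end
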